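import Summits.CriticalPhenomena.PercolationContinuityZ3.Theorems.Transplant.CayleyCylinderCycleBox
import Mathlib.Combinatorics.SimpleGraph.Prod
import HarnessLib

/-!
# Cylinders of a Cayley-graph skeleton XII — cycle kits in the PRODUCT `X □ Cay(Γ;S)` (thick frames in a fibre)

builds on p205010 (kernel theorem, internal audit signed; external expert review pending) — nothing in this file uses p205010.
Lane `prim-bschramm`, seat `prim-bschramm-p4` gen 11 (PART C3 of `P4-GENERAL.md`, residual (ii) of §32: `X □ Cay` for NON-Cayley `X`).
Helper file (`--supports stmt-CriticalPhenomena-4575 --as helper`).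

For a graph `X` on `W` and `E : CylData₂ Γ S`, the product cylinder graph is `X □ C_L`, `C_L = Cay(Γ;S)[‖φ‖_∞ ≤ L]`, `L = ℓ + 2r + 1`; the
enhancement class `pEenh ℓ` = edges not inside `W × {‖φ‖_∞ ≤ ℓ}`.  Two kinds of `SubLoc.CycleKit` at an edge of the small cylinder:
* a CAYLEY edge `{(u,x), (u,y)}`: the thick kit of file X copied into the fibre `{u} × C_L` (fibre copies of walks, `fib`);
* an `X`-EDGE `{(u,g), (u',g)}`: the column of `g` down to the floor in the fibre `u`, the `X`-edge at the floor point, the thick frame of `g`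
  (from its floor point to its ceiling point) in the fibre `u'`, and the column of `g` back down in the fibre `u'`.
Both lie in the ball of radius `R ℓ` about their first vertex; columns are `{u} × (s₀-string)`, constant for `(u, cls)`.
-/

noncomputable section

namespace Summit.CriticalPhenomena.PercolationContinuityZ3.Theorems.Transplant

open SimpleGraph Walk SubLoc Literature.Probability.LatticeModels Literature.Probability.Percolation
open Literature.Barriers.CriticalPhenomena (graphBall graphBall_mono mem_graphBall_self graphBall_finite)
open scoped Classical

/-! ## §1 Fibre walks in a box product -/

namespace CayCyl

namespace CylData₂

variable {W : Type} (X : SimpleGraph W) {Γ : Type} [Group Γ] {S : Finset Γ} (E : CylData₂ Γ S)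

/-- The product cylinder graph `X □ C_L`. [cite: BenjaminiSchramm1996, §2 (products)] -/
abbrev pcylG (L : ℕ) : SimpleGraph (W × E.enl.V L) := X □ E.cylG L

/-- **The fibre copy** `(u, ·)` of a walk of `C_L` inside `X □ C_L`. [folklore] -/
def fib {L : ℕ} (u : W) : ∀ {a b : E.enl.V L}, (E.cylG L).Walk a b → (E.pcylG X L).Walk (u, a) (u, b)
  | _, _, Walk.nil => Walk.nil
  | _, _, Walk.cons h p => Walk.cons (boxProd_adj_right.2 h) (fib u p)

/-- The support of a fibre copy. [folklore] -/
theorem support_fib {L : ℕ} (u : W) {a b : E.enl.V L} (w : (E.cylG L).Walk a b) :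
    (E.fib X u w).support = w.support.map fun z => (u, z) := by
  induction w with
  | nil => rfl
  | cons h p ih => rw [fib, support_cons, support_cons, ih, List.map_cons]

/-- Membership in the support of a fibre copy. [folklore] -/
theorem mem_support_fib {L : ℕ} {u : W} {a b : E.enl.V L} {w : (E.cylG L).Walk a b} {z : W × E.enl.V L} :
    z ∈ (E.fib X u w).support ↔ ∃ v ∈ w.support, z = (u, v) := by
  rw [support_fib, List.mem_map]
  constructor
  · rintro ⟨v, hv, rfl⟩; exact ⟨v, hv, rfl⟩
  · rintro ⟨v, hv, rfl⟩; exact ⟨v, hv, rfl⟩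

/-- The length of a fibre copy. [folklore] -/
@[simp] theorem length_fib {L : ℕ} (u : W) {a b : E.enl.V L} (w : (E.cylG L).Walk a b) : (E.fib X u w).length = w.length := by
  induction w with
  | nil => rfl
  | cons h p ih => rw [fib, length_cons, length_cons, ih]

/-- The edges of a fibre copy. [folklore] -/
theorem edges_fib {L : ℕ} (u : W) {a b : E.enl.V L} (w : (E.cylG L).Walk a b) :
    (E.fib X u w).edges = w.edges.map (Sym2.map fun z => (u, z)) := by
  induction w with
  | nil => rfl
  | cons h p ih => rw [fib, edges_cons, edges_cons, ih, List.map_cons, Sym2.map_mk]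

/-- A fibre copy of a path is a path. [folklore] -/
theorem isPath_fib {L : ℕ} (u : W) {a b : E.enl.V L} {w : (E.cylG L).Walk a b} (hw : w.IsPath) : (E.fib X u w).IsPath := by
  rw [Walk.isPath_def, support_fib]
  exact (List.nodup_map_iff (fun _ _ h => (Prod.mk.inj h).2)).2 ((Walk.isPath_def _).1 hw)

/-- The reverse of a fibre copy. [folklore] -/
theorem support_fib_reverse {L : ℕ} {u : W} {a b : E.enl.V L} {w : (E.cylG L).Walk a b} {z : W × E.enl.V L} :
    z ∈ (E.fib X u w).reverse.support ↔ ∃ v ∈ w.support, z = (u, v) := by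
  rw [mem_support_reverse_iff, mem_support_fib]

/-! ## §2 The enhancement class; the kit of a Cayley edge -/

/-- **The enhancement class of the product**: edges of `X □ C_L` not inside `W × {‖φ‖_∞ ≤ ℓ}`. [folklore] -/
def pEenh (ℓ : ℕ) : Set (Sym2 (W × E.enl.V (ℓ + 2 * E.r + 1))) :=
  {d | d ∈ (E.pcylG X (ℓ + 2 * E.r + 1)).edgeSet ∧ ¬ ∀ z ∈ d, E.φ z.2.1 ∈ box 2 ℓ}

section Kits

variable {ℓ : ℕ}

/-- Fibre images of enhancement edges are enhancement edges. [folklore] -/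
theorem map_fibre_mem_pEenh (u : W) {d : Sym2 (E.enl.V (ℓ + 2 * E.r + 1))} (hd : d ∈ E.Eenh ℓ) :
    d.map (fun z => (u, z)) ∈ E.pEenh X ℓ := by
  induction d using Sym2.inductionOn with
  | hf a b =>
    refine ⟨?_, fun hall => hd.2 fun z hz => ?_⟩
    · rw [Sym2.map_mk]
      exact boxProd_adj_right.2 hd.1
    · rcases Sym2.mem_iff.1 hz with rfl | rfl
      · exact hall (u, z) (by rw [Sym2.map_mk]; exact Sym2.mem_mk_left _ _)
      · exact hall (u, z) (by rw [Sym2.map_mk]; exact Sym2.mem_mk_right _ _)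

/-- **The kit of a CAYLEY edge** `{(u,x), (u',y)}`, `u = u'`, of the small cylinder: the thick kit of file X copied into the fibre `u`
(the two labels `u, u'` of the same fibre keep the endpoints syntactically free). [folklore] -/
def kitCay (u u' : W) (huu : u = u') (x y : E.enl.V (ℓ + 2 * E.r + 1)) (hx : E.φ x.1 ∈ box 2 ℓ) (hy : E.φ y.1 ∈ box 2 ℓ)
    (hadj : (E.cylG (ℓ + 2 * E.r + 1)).Adj x y) (hne : y.1 ≠ x.1 * E.enl.s₀⁻¹) :
    CycleKit (E.pcylG X (ℓ + 2 * E.r + 1)) (E.pEenh X ℓ) (u, x) (u', y) where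
  p := (u, E.enl.pV x)
  q := (u', E.enl.qV y)
  A := E.fib X u (E.colA x)
  M := (E.fib X u (E.pathM x y)).copy rfl (by rw [huu])
  B := E.fib X u' (E.colB y)
  hA := E.isPath_fib X u (E.kit x y hx hy hadj hne).hA
  hM := by rw [Walk.isPath_copy]; exact E.isPath_fib X u (E.kit x y hx hy hadj hne).hM
  hB := E.isPath_fib X u' (E.kit x y hx hy hadj hne).hB
  hpq := fun h => (E.kit x y hx hy hadj hne).hpq (Prod.mk.inj h).2
  hxp := fun h => (E.kit x y hx hy hadj hne).hxp (Prod.mk.inj h).2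
  hqy := fun h => (E.kit x y hx hy hadj hne).hqy (Prod.mk.inj h).2
  hAM := fun w h1 h2 => by
    rw [support_copy] at h2
    obtain ⟨a, ha, rfl⟩ := (E.mem_support_fib X).1 h1
    obtain ⟨m, hm, hfm⟩ := (E.mem_support_fib X).1 h2
    rw [(Prod.mk.inj hfm).2] at ha ⊢
    exact congrArg (Prod.mk u) ((E.kit x y hx hy hadj hne).hAM m ha hm)
  hMB := fun w h1 h2 => by
    subst huu
    rw [support_copy] at h1
    obtain ⟨a, ha, rfl⟩ := (E.mem_support_fib X).1 h1
    obtain ⟨m, hm, hfm⟩ := (E.mem_support_fib X).1 h2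
    rw [(Prod.mk.inj hfm).2] at ha ⊢
    exact congrArg (Prod.mk u) ((E.kit x y hx hy hadj hne).hMB m ha hm)
  hAB := fun w h1 h2 => by
    subst huu
    obtain ⟨a, ha, rfl⟩ := (E.mem_support_fib X).1 h1
    obtain ⟨m, hm, hfm⟩ := (E.mem_support_fib X).1 h2
    rw [(Prod.mk.inj hfm).2] at ha
    exact (E.kit x y hx hy hadj hne).hAB m ha hm
  hME := fun d hd => by
    rw [edges_copy, edges_fib, List.mem_map] at hd
    obtain ⟨d', hd', rfl⟩ := hd
    exact E.map_fibre_mem_pEenh X u ((E.kit x y hx hy hadj hne).hME d' hd')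
  hyx := by subst huu; exact boxProd_adj_right.2 hadj.symm

/-- Vertices of the zone of the Cayley-edge kit are fibre copies of the zone of the thick kit. [folklore] -/
theorem kitCay_Z (u u' : W) (huu : u = u') (x y : E.enl.V (ℓ + 2 * E.r + 1)) (hx : E.φ x.1 ∈ box 2 ℓ) (hy : E.φ y.1 ∈ box 2 ℓ)
    (hadj : (E.cylG (ℓ + 2 * E.r + 1)).Adj x y) (hne : y.1 ≠ x.1 * E.enl.s₀⁻¹) {w : W × E.enl.V (ℓ + 2 * E.r + 1)}
    (hw : w ∈ (E.kitCay X u u' huu x y hx hy hadj hne).Z) : ∃ v ∈ (E.kit x y hx hy hadj hne).Z, w = (u, v) := by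
  subst huu
  rcases hw with hw | hw | hw
  · obtain ⟨v, hv, rfl⟩ := (E.mem_support_fib X).1 hw; exact ⟨v, Or.inl hv, rfl⟩
  · change w ∈ ((E.fib X u (E.pathM x y)).copy rfl rfl).support at hw
    rw [support_copy] at hw
    obtain ⟨v, hv, rfl⟩ := (E.mem_support_fib X).1 hw; exact ⟨v, Or.inr (Or.inl hv), rfl⟩
  · obtain ⟨v, hv, rfl⟩ := (E.mem_support_fib X).1 hw; exact ⟨v, Or.inr (Or.inr hv), rfl⟩

/-! ### The kit of an `X`-edge -/

variable (g g' : E.enl.V (ℓ + 2 * E.r + 1))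

/-- The frame meets the column of `y` (upwards) only at the ceiling point. [folklore] -/
theorem pathM_colB (hy : E.φ g'.1 ∈ box 2 ℓ) {m : E.enl.V (ℓ + 2 * E.r + 1)} (h1 : m ∈ (E.pathM g g').support)
    (h2 : m ∈ (E.colB g').support) : m = E.enl.qV g' := by
  obtain ⟨j, hj, hw⟩ := E.mem_colBE g' h2
  have hfr := (E.frame_mem g g' (E.mem_pathME g g' h1)).2
  have hc := E.enl.φ_s₀_pow g'.1 j
  rw [enl_φ] at hc
  have hgb := CylData₁.mem_box_two.1 hy; rw [abs_le, abs_le] at hgb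
  rw [hw, hc.1, hc.2] at hfr
  have hj' : (j : ℤ) ≤ E.enl.nB g' := by exact_mod_cast hj
  have e := E.enl.nB_eq g'; rw [enl_φ] at e; push_cast at e
  rcases hfr with hfr | hfr | hfr
  · omega
  · have hjnB : j = E.enl.nB g' := by omega
    apply Subtype.ext
    rw [hw, hjnB]
  · omega

variable {u u' : W}

/-- The run of the `X`-edge kit: the `X`-edge at the floor point, then the thick frame from `g` to `g'` in the fibre `u'`. [folklore] -/
def runX (hu : X.Adj u u') : (E.pcylG X (ℓ + 2 * E.r + 1)).Walk (u, E.enl.pV g) (u', E.enl.qV g') :=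
  Walk.cons (boxProd_adj_left.2 hu) (E.fib X u' (E.pathM g g'))

/-- **The kit of an `X`-EDGE** `{(u,g), (u',g')}`, `g = g'`, over a small-cylinder vertex (two labels keep the endpoints free). [folklore] -/
def kitX (hu : X.Adj u u') (hgg : g = g') (hg : E.φ g.1 ∈ box 2 ℓ) :
    CycleKit (E.pcylG X (ℓ + 2 * E.r + 1)) (E.pEenh X ℓ) (u, g) (u', g') where
  p := (u, E.enl.pV g)
  q := (u', E.enl.qV g')
  A := E.fib X u (E.colA g)
  M := E.runX X g g' hu
  B := E.fib X u' (E.colB g')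
  hA := E.isPath_fib X u (show (E.colA g).IsPath from (isPath_induce_iff _ _).2 (isPath_powWalk _ E.enl.s₀inv_pow_injective _ _))
  hM := by
    rw [runX, Walk.cons_isPath_iff]
    refine ⟨E.isPath_fib X u' (bypass_isPath _), fun h => ?_⟩
    obtain ⟨m, -, hm⟩ := (E.mem_support_fib X).1 h
    exact hu.ne (Prod.mk.inj hm).1
  hB := E.isPath_fib X u'
    (show (E.colB g').IsPath from ((isPath_induce_iff _ _).2 (isPath_powWalk _ E.enl.s₀_pow_injective _ _)).reverse)
  hpq := fun h => hu.ne (Prod.mk.inj h).1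
  hxp := fun h => by
    have h1 := (E.enl.φ_pt g).1
    have hg0 := (CylData₁.mem_box_two.1 hg).1; rw [abs_le] at hg0
    have e : g.1 = E.enl.pt g := congrArg Subtype.val (Prod.mk.inj h).2
    rw [← e, enl_φ] at h1; omega
  hqy := fun h => by
    subst hgg
    have h1 := (E.enl.φ_qt g).1
    have hg0 := (CylData₁.mem_box_two.1 hg).1; rw [abs_le] at hg0
    have e : E.enl.qt g = g.1 := congrArg Subtype.val (Prod.mk.inj h).2
    rw [e, enl_φ] at h1; omega
  hAM := fun w h1 h2 => by
    obtain ⟨a, -, rfl⟩ := (E.mem_support_fib X).1 h1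
    rw [runX, Walk.support_cons, List.mem_cons] at h2
    rcases h2 with h2 | h2
    · exact h2
    · obtain ⟨m, -, hm⟩ := (E.mem_support_fib X).1 h2
      exact absurd (Prod.mk.inj hm).1 hu.ne
  hMB := fun w h1 h2 => by
    obtain ⟨b, hb, rfl⟩ := (E.mem_support_fib X).1 h2
    rw [runX, Walk.support_cons, List.mem_cons] at h1
    rcases h1 with h1 | h1
    · exact absurd (Prod.mk.inj h1).1.symm hu.ne
    · obtain ⟨m, hm, hmb⟩ := (E.mem_support_fib X).1 h1
      have hmb' : b = m := (Prod.mk.inj hmb).2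
      rw [hmb'] at hb ⊢
      rw [E.pathM_colB g g' (hgg ▸ hg) hm hb]
  hAB := fun w h1 h2 => by
    obtain ⟨a, -, rfl⟩ := (E.mem_support_fib X).1 h1
    obtain ⟨b, -, hb⟩ := (E.mem_support_fib X).1 h2
    exact hu.ne (Prod.mk.inj hb).1
  hME := fun d hd => by
    rw [runX, Walk.edges_cons, List.mem_cons, edges_fib, List.mem_map] at hd
    rcases hd with rfl | ⟨d', hd', rfl⟩
    · refine ⟨boxProd_adj_left.2 hu, fun hall => ?_⟩
      have h := hall (u, E.enl.pV g) (Sym2.mem_mk_left _ _)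
      have h1 := (E.enl.φ_pt g).1
      rw [enl_φ] at h1
      have hb := (CylData₁.mem_box_two.1 h).1
      rw [abs_le] at hb
      simp only at hb
      omega
    · refine E.map_fibre_mem_pEenh X u' ⟨Walk.edges_subset_edgeSet _ hd', fun hall => ?_⟩
      induction d' using Sym2.inductionOn with
      | hf a b =>
        have ha : a ∈ (E.pathM g g').support := Walk.fst_mem_support_of_mem_edges _ hd'
        exact E.pathM_out g g' ha (hall a (Sym2.mem_mk_left _ _))
  hyx := by subst hgg; exact boxProd_adj_left.2 hu.symm

/-! ## §3 Zone radii -/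

/-- The closing kernel element of the frame of `g` with itself lies in the ball of radius `ρ ℓ`. [folklore] -/
theorem kel_self_mem_kballE : E.kel g g ∈ E.kballE ℓ := by
  have hc := E.counts_leE g g
  let W₁ : (mulCayley (S : Set Γ)).Walk (E.enl.pt g) (E.cc g) :=
    (powWalk S E.adjE_s₁ (E.enl.pt g) (E.enl.m₁ g)).append
      ((powWalk S E.adjE_s₀ (E.c₁ g) (E.n₀ ℓ)).append (powWalk S E.adjE_s₁_inv (E.c₂ g) E.r))
  let W₂ : (mulCayley (S : Set Γ)).Walk g.1 (E.enl.pt g) := powWalk S E.adjE_s₀_inv g.1 (E.enl.nA g)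
  let W₃ : (mulCayley (S : Set Γ)).Walk g.1 (E.enl.qt g * E.enl.s₁ ^ E.enl.m₂ g * E.enl.s₀⁻¹ ^ E.r * E.enl.s₁⁻¹ ^ E.r) :=
    (powWalk S E.adjE_s₀ g.1 (E.enl.nB g)).append
      ((powWalk S E.adjE_s₁ (E.enl.qt g) (E.enl.m₂ g)).append
        ((powWalk S E.adjE_s₀_inv (E.enl.qt g * E.enl.s₁ ^ E.enl.m₂ g) E.r).append
          (powWalk S E.adjE_s₁_inv (E.enl.qt g * E.enl.s₁ ^ E.enl.m₂ g * E.enl.s₀⁻¹ ^ E.r) E.r)))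
  have hend : E.enl.qt g * E.enl.s₁ ^ E.enl.m₂ g * E.enl.s₀⁻¹ ^ E.r * E.enl.s₁⁻¹ ^ E.r = E.cc g * E.kel g g := by
    rw [kel, inv_pow, inv_pow]
    simp only [mul_assoc, mul_inv_cancel_left]
  let Wt : (mulCayley (S : Set Γ)).Walk (E.cc g) (E.cc g * E.kel g g) := W₁.reverse.append (W₂.reverse.append (W₃.copy rfl hend))
  have hn : E.n₀ ℓ = 2 * ℓ + 3 * E.r + 2 := rfl
  have hρ : E.ρ ℓ = 10 * ℓ + 22 * E.r + 11 := rfl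
  have hlen : Wt.length ≤ E.ρ ℓ := by
    simp only [Wt, W₁, W₂, W₃, Walk.length_append, Walk.length_reverse, Walk.length_copy, length_powWalk]
    omega
  rw [kballE, Set.Finite.mem_toFinset]
  refine ⟨(lmul S (E.cc g)⁻¹ Wt).copy (inv_mul_cancel _) (by rw [inv_mul_cancel_left]), ?_⟩
  rw [length_copy, length_lmul]
  exact hlen

/-- The frame of `g` with `g' = g` is short: `|M| ≤ 8L + Kmax`. [folklore] -/
theorem length_pathM_le_of_eq (hgg : g = g') : (E.pathM g g').length ≤ 8 * (ℓ + 2 * E.r + 1) + E.Kmax ℓ := by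
  subst hgg
  refine (length_bypass_le_length _).trans ?_
  rw [length_induce, length_frameE]
  have hc := E.counts_leE g g
  have hk : E.boxLen (E.kel g g) ≤ E.Kmax ℓ := Finset.le_sup (f := E.boxLen) (E.kel_self_mem_kballE g)
  have hn : E.n₀ ℓ = 2 * ℓ + 3 * E.r + 2 := rfl
  omega

/-- A walk of a fibre gives a walk of the product of the same length. [folklore] -/
theorem graphBall_fibre {L : ℕ} (w : W) {a b : E.enl.V L} {n : ℕ} (h : b ∈ graphBall (E.cylG L) a n) :
    (w, b) ∈ graphBall (E.pcylG X L) (w, a) n := by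
  obtain ⟨p, hp⟩ := h
  exact ⟨E.fib X w p, by rw [length_fib]; exact hp⟩

/-- **The Cayley-edge kit lies in the ball of radius `R ℓ`.** [folklore] -/
theorem kitCay_Z_subset (u u' : W) (huu : u = u') (x y : E.enl.V (ℓ + 2 * E.r + 1)) (hx : E.φ x.1 ∈ box 2 ℓ) (hy : E.φ y.1 ∈ box 2 ℓ)
    (hadj : (E.cylG (ℓ + 2 * E.r + 1)).Adj x y) (hne : y.1 ≠ x.1 * E.enl.s₀⁻¹) :
    (E.kitCay X u u' huu x y hx hy hadj hne).Z ⊆ graphBall (E.pcylG X (ℓ + 2 * E.r + 1)) (u, x) (E.R ℓ) := by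
  intro w hw
  obtain ⟨a, ha, rfl⟩ := E.kitCay_Z X u u' huu x y hx hy hadj hne hw
  exact E.graphBall_fibre X u (E.kit_Z_subset x y hx hy hadj hne ha)

/-- **The `X`-edge kit lies in the ball of radius `R ℓ`.** [folklore] -/
theorem kitX_Z_subset (hu : X.Adj u u') (hgg : g = g') (hg : E.φ g.1 ∈ box 2 ℓ) :
    (E.kitX X g g' hu hgg hg).Z ⊆ graphBall (E.pcylG X (ℓ + 2 * E.r + 1)) (u, g) (E.R ℓ) := by
  have hc := E.counts_leE g g'
  have hAB := E.length_cols g g'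
  have hM := E.length_pathM_le_of_eq g g' hgg
  have hA : (E.fib X u (E.colA g)).length = E.enl.nA g := by rw [length_fib]; exact hAB.1
  rintro w (hw | hw | hw)
  · refine ⟨(E.fib X u (E.colA g)).takeUntil w hw, ?_⟩
    have := (E.fib X u (E.colA g)).length_takeUntil_le_length hw
    unfold R; omega
  · refine ⟨(E.fib X u (E.colA g)).append ((E.runX X g g' hu).takeUntil w hw), ?_⟩
    have := (E.runX X g g' hu).length_takeUntil_le_length hw
    have hrun : (E.runX X g g' hu).length = (E.pathM g g').length + 1 := by rw [runX, Walk.length_cons, length_fib]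
    rw [Walk.length_append]; unfold R; omega
  · subst hgg
    have hw' : w ∈ (E.fib X u' (E.colB g)).reverse.support := (mem_support_reverse_iff _ w).2 hw
    refine ⟨Walk.cons (boxProd_adj_left.2 hu) ((E.fib X u' (E.colB g)).reverse.takeUntil w hw'), ?_⟩
    have := (E.fib X u' (E.colB g)).reverse.length_takeUntil_le_length hw'
    rw [length_reverse, length_fib] at this
    rw [Walk.length_cons]; unfold R; omega

/-! ## §4 Column classes in the product -/

/-- The column of the Cayley-edge kit lies in the fibre `u` and the class of `x`. [folklore] -/
theorem fst_cls_kitCay_A (u u' : W) (huu : u = u') (x y : E.enl.V (ℓ + 2 * E.r + 1)) (hx : E.φ x.1 ∈ box 2 ℓ)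
    (hy : E.φ y.1 ∈ box 2 ℓ) (hadj : (E.cylG (ℓ + 2 * E.r + 1)).Adj x y) (hne : y.1 ≠ x.1 * E.enl.s₀⁻¹)
    {w : W × E.enl.V (ℓ + 2 * E.r + 1)} (hw : w ∈ (E.kitCay X u u' huu x y hx hy hadj hne).A.support) :
    w.1 = u ∧ E.enl.cls w.2.1 = E.enl.cls x.1 := by
  obtain ⟨a, ha, rfl⟩ := (E.mem_support_fib X).1 hw
  exact ⟨rfl, E.cls_colAE x ha⟩

/-- The column of the Cayley-edge kit at `y` lies in the fibre `u` and the class of `y`. [folklore] -/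
theorem fst_cls_kitCay_B (u u' : W) (huu : u = u') (x y : E.enl.V (ℓ + 2 * E.r + 1)) (hx : E.φ x.1 ∈ box 2 ℓ)
    (hy : E.φ y.1 ∈ box 2 ℓ) (hadj : (E.cylG (ℓ + 2 * E.r + 1)).Adj x y) (hne : y.1 ≠ x.1 * E.enl.s₀⁻¹)
    {w : W × E.enl.V (ℓ + 2 * E.r + 1)} (hw : w ∈ (E.kitCay X u u' huu x y hx hy hadj hne).B.support) :
    w.1 = u' ∧ E.enl.cls w.2.1 = E.enl.cls y.1 := by
  obtain ⟨a, ha, rfl⟩ := (E.mem_support_fib X).1 hw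
  exact ⟨rfl, E.cls_colBE y ha⟩

/-- The column `A` of the `X`-edge kit lies in the fibre `u` and the class of `g`. [folklore] -/
theorem fst_cls_kitX_A (hu : X.Adj u u') (hgg : g = g') (hg : E.φ g.1 ∈ box 2 ℓ) {w : W × E.enl.V (ℓ + 2 * E.r + 1)}
    (hw : w ∈ (E.kitX X g g' hu hgg hg).A.support) : w.1 = u ∧ E.enl.cls w.2.1 = E.enl.cls g.1 := by
  obtain ⟨a, ha, rfl⟩ := (E.mem_support_fib X).1 hw
  exact ⟨rfl, E.cls_colAE g ha⟩

/-- The column `B` of the `X`-edge kit lies in the fibre `u'` and the class of `g`. [folklore] -/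
theorem fst_cls_kitX_B (hu : X.Adj u u') (hgg : g = g') (hg : E.φ g.1 ∈ box 2 ℓ) {w : W × E.enl.V (ℓ + 2 * E.r + 1)}
    (hw : w ∈ (E.kitX X g g' hu hgg hg).B.support) : w.1 = u' ∧ E.enl.cls w.2.1 = E.enl.cls g'.1 := by
  obtain ⟨a, ha, rfl⟩ := (E.mem_support_fib X).1 hw
  exact ⟨rfl, E.cls_colBE g' ha⟩

end Kits

end CylData₂

end CayCyl

end Summit.CriticalPhenomena.PercolationContinuityZ3.Theorems.Transplant

end
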